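import Mathlib.Combinatorics.SimpleGraph.Clique
import Literature.Computability.Complexity.CNF
import HarnessLib

/-!
# Karp's reduction `SATISFIABILITY ∝ CLIQUE`: the combinatorial half (Karp 1972, §4)

R. M. Karp, *Reducibility among combinatorial problems* (1972), §4, proof of the Main Theorem:
"SATISFIABILITY ∝ CLIQUE. `N = {⟨σ, i⟩ | σ is a literal and occurs in Cᵢ}`,
`A = {{⟨σ, i⟩, ⟨δ, j⟩} | i ≠ j and σ ≠ δ̄}`, `k = p`, the number of clauses." This file proves the
correctness of that reduction in the form consumed by the polynomial-time map of
`KarpCliqueReduction.lean`, which reads a CNF code token by token: the vertices are the literal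
OCCURRENCES in reading order, each annotated with the (1-based) number of its clause among the
nonempty clauses read so far, its variable (a binary numeral) and its polarity —

* `Ann = ℕ × List Bool × Bool` (clause number, variable numeral, polarity), `annot k φ` the
  annotated occurrence list of `φ : CNF ℕ` (clause numbers starting after `k`);
* `compatB x y` — Karp's adjacency "`i ≠ j` and `σ ≠ δ̄`" as a Boolean: different clause numbers and
  not a complementary pair; `graphOf A : SimpleGraph (Fin |A|)`, `Adj p q := compatB A[p] A[q]`;
* the two membership facts about `annot` the proof needs: clause numbers lie in `[k+1, k+ne φ]`
  (`fst_mem_annot_bounds`, `ne φ` = number of nonempty clauses), and, when no clause is empty,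
  `x ∈ annot k φ ↔ x = (k+i+1, ⟨l⟩)` for some literal `l` of clause `i` (`mem_annot_iff`);
* **`karp_clique_iff`**: for any list `A` with these two properties (in particular `annot 0 φ`),
  `graphOf A` has a `|φ|`-clique iff `φ` is satisfiable. (⇐) a satisfying assignment picks a true
  literal in every clause; their occurrences are pairwise adjacent. (⇒) the vertices of a `|φ|`-clique
  carry pairwise distinct clause numbers in `[1, ne φ] ⊆ [1, |φ|]`, so no clause is empty and every
  clause is hit; "`S` does not contain a complementary pair of literals" (Karp's phrasing of
  SATISFIABILITY, §3), so setting the literals of the clique true is a consistent assignment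
  satisfying every clause.

Pure combinatorics (no machines); the vertex set differs from Karp's `N` only in that a literal
repeated inside one clause gives two (non-adjacent, twin) vertices, which changes no clique number.

## References

* R. M. Karp, *Reducibility among combinatorial problems*, in: R. E. Miller, J. W. Thatcher (eds.),
  Complexity of Computer Computations, Plenum 1972, 85–103, §4 (Main Theorem, problem 3;
  "SATISFIABILITY ∝ CLIQUE"), §3 (SATISFIABILITY: "a set `S` … not containing a complementary pair").
* S. A. Cook, *The complexity of theorem-proving procedures*, Proc. 3rd STOC (1971) (the reduction
  is "implicit in Cook", Karp §4).
-/

namespace Literature.Computability.Complexity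

open _root_.Computability Finset

namespace KarpClique

/-! ### Annotated occurrences and Karp's adjacency -/

/-- An annotated literal occurrence: clause number, variable (binary numeral), polarity.
[cite: Karp1972, §4 (SATISFIABILITY ∝ CLIQUE: the nodes ⟨σ, i⟩)] -/
abbrev Ann : Type := ℕ × List Bool × Bool

/-- **Karp's adjacency** of two annotated occurrences `x = ⟨i, σ⟩` (row) and `y = ⟨j, δ⟩` (column):
`j ≠ i` and `σ ≠ δ̄` (same variable forces same polarity), as a Boolean.
[cite: Karp1972, §4 (SATISFIABILITY ∝ CLIQUE: A = {{⟨σ,i⟩,⟨δ,j⟩} | i ≠ j and σ ≠ δ̄})] -/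
def compatB (x y : Ann) : Bool :=
  !decide (y.1 = x.1) && !(decide (x.2.1 = y.2.1) && !decide (x.2.2 = y.2.2))

/-- Truth of `compatB`. [cite: Karp1972, §4 (SATISFIABILITY ∝ CLIQUE)] -/
theorem compatB_eq_true_iff (x y : Ann) :
    compatB x y = true ↔ y.1 ≠ x.1 ∧ (x.2.1 = y.2.1 → x.2.2 = y.2.2) := by
  unfold compatB
  by_cases h1 : y.1 = x.1 <;> by_cases h2 : x.2.1 = y.2.1 <;> by_cases h3 : x.2.2 = y.2.2 <;> simp [h1, h2, h3]

/-- Karp's adjacency is symmetric. [folklore] -/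
theorem compatB_comm (x y : Ann) : compatB x y = compatB y x := by
  unfold compatB
  rw [show decide (y.1 = x.1) = decide (x.1 = y.1) from Bool.decide_congr eq_comm,
    show decide (x.2.1 = y.2.1) = decide (y.2.1 = x.2.1) from Bool.decide_congr eq_comm,
    show decide (x.2.2 = y.2.2) = decide (y.2.2 = x.2.2) from Bool.decide_congr eq_comm]

/-- Karp's adjacency is irreflexive (a node is in its own clause). [folklore] -/
theorem compatB_self (x : Ann) : compatB x x = false := by
  simp [compatB]

/-- **Karp's graph** on the positions of an annotated occurrence list `A`: positions `p`, `q` are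
adjacent iff `compatB A[p] A[q]`. [cite: Karp1972, §4 (SATISFIABILITY ∝ CLIQUE)] -/
def graphOf (A : List Ann) : SimpleGraph (Fin A.length) where
  Adj p q := compatB A[p] A[q] = true
  symm := ⟨fun p q h => by rw [compatB_comm]; exact h⟩
  loopless := ⟨fun p h => by rw [compatB_self] at h; exact Bool.false_ne_true h⟩

/-- Unfolding the adjacency of `graphOf`. [folklore] -/
theorem graphOf_adj (A : List Ann) (p q : Fin A.length) : (graphOf A).Adj p q ↔ compatB A[p] A[q] = true :=
  Iff.rfl

/-- Adjacency of `graphOf` is decidable. [folklore] -/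
instance graphOf.decidableRel (A : List Ann) : DecidableRel (graphOf A).Adj := fun p q => by
  rw [graphOf_adj]; infer_instance

/-! ### The annotated occurrence list of a CNF -/

/-- The annotated occurrence of a literal `l = (v, b)` in clause number `i`: `(i, encodeNat v, b)`.
[cite: Karp1972, §4 (the node ⟨σ, i⟩)] -/
def annLit (i : ℕ) (l : Literal ℕ) : Ann := (i, encodeNat l.1, l.2)

/-- **The annotated occurrence list of `φ`**, clause numbers counting the nonempty clauses from
`k + 1` on (an empty clause has no occurrence and takes no number). [cite: Karp1972, §4 (N = {⟨σ, i⟩ | σ occurs in Cᵢ})] -/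
def annot : ℕ → CNF ℕ → List Ann
  | _, [] => []
  | k, c :: φ => (c.map (annLit (k + 1))) ++ annot (if c = [] then k else k + 1) φ

/-- The number of nonempty clauses. [folklore] -/
def ne (φ : CNF ℕ) : ℕ := (φ.filter (· ≠ [])).length

/-- At most as many nonempty clauses as clauses. [folklore] -/
theorem ne_le_length (φ : CNF ℕ) : ne φ ≤ φ.length := List.length_filter_le _ _

/-- All clauses are nonempty iff `ne φ = |φ|`. [folklore] -/
theorem ne_eq_length_iff (φ : CNF ℕ) : ne φ = φ.length ↔ ∀ c ∈ φ, c ≠ [] := by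
  unfold ne
  rw [List.length_filter_eq_length_iff]
  simp

/-- `ne` of a cons. [folklore] -/
theorem ne_cons (c : Clause ℕ) (φ : CNF ℕ) : ne (c :: φ) = (if c = [] then 0 else 1) + ne φ := by
  unfold ne
  by_cases h : c = [] <;> simp [h, Nat.add_comm]

/-- **Clause numbers of annotated occurrences lie in `[k + 1, k + ne φ]`.** [folklore] -/
theorem fst_mem_annot_bounds : ∀ (k : ℕ) (φ : CNF ℕ) (x : Ann), x ∈ annot k φ → k + 1 ≤ x.1 ∧ x.1 ≤ k + ne φ
  | k, [], x, hx => by simp [annot] at hx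
  | k, c :: φ, x, hx => by
    rw [annot, List.mem_append, List.mem_map] at hx
    rw [ne_cons]
    rcases hx with ⟨l, hl, rfl⟩ | hx
    · have hc : c ≠ [] := List.ne_nil_of_mem hl
      simp [annLit, hc]
    · by_cases hc : c = []
      · rw [if_pos hc] at hx; rw [if_pos hc]
        simpa using fst_mem_annot_bounds k φ x hx
      · rw [if_neg hc] at hx; rw [if_neg hc]
        have := fst_mem_annot_bounds (k + 1) φ x hx
        omega

/-- **Membership in the annotated list when no clause is empty**: exactly the annotated literals
`(k + i + 1, ⟨l⟩)` of the literals `l` of clause `i`. [folklore] -/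
theorem mem_annot_iff : ∀ (k : ℕ) (φ : CNF ℕ), (∀ c ∈ φ, c ≠ []) → ∀ x : Ann,
    x ∈ annot k φ ↔ ∃ (i : ℕ) (hi : i < φ.length), ∃ l ∈ φ[i], x = annLit (k + i + 1) l
  | k, [], _, x => by simp [annot]
  | k, c :: φ, h, x => by
    have hc : c ≠ [] := h c (by simp)
    have hφ : ∀ c' ∈ φ, c' ≠ [] := fun c' hc' => h c' (by simp [hc'])
    rw [annot, if_neg hc, List.mem_append, List.mem_map, mem_annot_iff (k + 1) φ hφ x]
    constructor
    · rintro (⟨l, hl, rfl⟩ | ⟨i, hi, l, hl, rfl⟩)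
      · exact ⟨0, by simp, l, by simpa using hl, rfl⟩
      · exact ⟨i + 1, by simpa using hi, l, by simpa using hl, by rw [show k + 1 + i + 1 = k + (i + 1) + 1 by ring]⟩
    · rintro ⟨i, hi, l, hl, rfl⟩
      cases i with
      | zero => exact Or.inl ⟨l, by simpa using hl, rfl⟩
      | succ i =>
        exact Or.inr ⟨i, by simpa using hi, l, by simpa using hl, by rw [show k + 1 + i + 1 = k + (i + 1) + 1 by ring]⟩

/-! ### Karp's correctness argument -/

section Karp

variable {A : List Ann} {φ : CNF ℕ}

/-- A clause is true iff one of its literals is. [cite: AroraBarakCC2009, Def. 2.9] -/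
theorem clause_eval_eq_true_iff (σ : ℕ → Bool) (c : Clause ℕ) :
    Clause.eval σ c = true ↔ ∃ l ∈ c, Literal.eval σ l = true := by
  simp [Clause.eval, List.any_eq_true]

/-- **Completeness of Karp's reduction**: a satisfying assignment makes one literal of every clause
true, and the occurrences of these literals are pairwise adjacent (different clauses; two true
literals are never complementary) — a `|φ|`-clique. Needs only: the annotated true literals belong
to `A`. [cite: Karp1972, §4 (SATISFIABILITY ∝ CLIQUE)] -/
theorem not_cliqueFree_of_satisfiable
    (h2 : (∀ c ∈ φ, c ≠ []) → ∀ x : Ann, x ∈ A ↔ ∃ (i : ℕ) (_ : i < φ.length), ∃ l ∈ φ[i], x = annLit (i + 1) l)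
    (hsat : φ.Satisfiable) : ¬ (graphOf A).CliqueFree φ.length := by
  obtain ⟨σ, hσ⟩ := hsat
  rw [CNF.eval_eq_true_iff] at hσ
  have hne : ∀ c ∈ φ, c ≠ [] := by
    rintro c hc rfl
    simpa [Clause.eval] using hσ [] hc
  -- a true literal in every clause
  have hlit : ∀ i : Fin φ.length, ∃ l ∈ φ[i], Literal.eval σ l = true := fun i =>
    (clause_eval_eq_true_iff σ _).1 (hσ _ (List.getElem_mem i.isLt))
  choose lit hlit_mem hlit_true using hlit
  -- their annotated occurrences are nodes
  have hposEx : ∀ i : Fin φ.length, ∃ p : Fin A.length, A[p] = annLit (i + 1) (lit i) := fun i => by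
    obtain ⟨p, hp, hpe⟩ := List.mem_iff_getElem.1 ((h2 hne _).2 ⟨i, i.isLt, lit i, hlit_mem i, rfl⟩)
    exact ⟨⟨p, hp⟩, hpe⟩
  choose pos hpos using hposEx
  have hinj : Function.Injective pos := fun i j hij => by
    have e := congrArg (fun p => (A[p]).1) hij
    simp only [hpos, annLit] at e
    exact Fin.ext (by omega)
  refine fun hfree => hfree (Finset.univ.image pos) ⟨?_, ?_⟩
  · intro p hp q hq hpq
    simp only [Finset.coe_image, Finset.coe_univ, Set.image_univ, Set.mem_range] at hp hq
    obtain ⟨i, rfl⟩ := hp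
    obtain ⟨j, rfl⟩ := hq
    have hij : i ≠ j := fun h => hpq (by rw [h])
    rw [graphOf_adj, hpos, hpos, compatB_eq_true_iff]
    refine ⟨fun h => hij (Fin.ext ?_), fun hv => ?_⟩
    · simp only [annLit] at h
      omega
    · simp only [annLit] at hv ⊢
      have hv' : (lit i).1 = (lit j).1 := by simpa using congrArg decodeNat hv
      have e1 := hlit_true i
      have e2 := hlit_true j
      simp only [Literal.eval, beq_iff_eq] at e1 e2
      rw [← e1, ← e2, hv']
  · rw [Finset.card_image_of_injective _ hinj, Finset.card_univ, Fintype.card_fin]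

/-- **Soundness of Karp's reduction**: the nodes of a `|φ|`-clique have pairwise distinct clause
numbers, all in `[1, ne φ] ⊆ [1, |φ|]`; so no clause is empty, every clause is hit, and — the clique
containing no complementary pair — making its literals true is a well-defined assignment satisfying
every clause. [cite: Karp1972, §4 (SATISFIABILITY ∝ CLIQUE) and §3 (SATISFIABILITY)] -/
theorem satisfiable_of_not_cliqueFree (h1 : ∀ x ∈ A, 1 ≤ x.1 ∧ x.1 ≤ ne φ)
    (h2 : (∀ c ∈ φ, c ≠ []) → ∀ x : Ann, x ∈ A ↔ ∃ (i : ℕ) (_ : i < φ.length), ∃ l ∈ φ[i], x = annLit (i + 1) l)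
    (h : ¬ (graphOf A).CliqueFree φ.length) : φ.Satisfiable := by
  classical
  obtain ⟨s, hs⟩ : ∃ s, (graphOf A).IsNClique φ.length s := by simpa [SimpleGraph.CliqueFree] using h
  have hmemA : ∀ p : Fin A.length, A[p] ∈ A := fun p => by
    rw [Fin.getElem_fin]
    exact List.getElem_mem p.isLt
  -- pairwise compatible nodes
  have hadj : ∀ p ∈ s, ∀ q ∈ s, p ≠ q → compatB A[p] A[q] = true := fun p hp q hq hpq =>
    hs.isClique (Finset.mem_coe.2 hp) (Finset.mem_coe.2 hq) hpq
  -- distinct nodes of the clique carry distinct clause numbers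
  have hinj : Set.InjOn (fun p : Fin A.length => (A[p]).1) s := fun p hp q hq hpq => by
    by_contra hne
    exact ((compatB_eq_true_iff _ _).1 (hadj p hp q hq hne)).1 (Eq.symm hpq)
  set C := s.image (fun p : Fin A.length => (A[p]).1) with hC
  have hCcard : C.card = φ.length := by rw [hC, Finset.card_image_of_injOn hinj, hs.card_eq]
  have hCsub : C ⊆ Finset.Icc 1 (ne φ) := by
    intro c hc
    rw [hC, Finset.mem_image] at hc
    obtain ⟨p, -, rfl⟩ := hc
    rw [Finset.mem_Icc]
    exact h1 _ (hmemA _)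
  -- hence no clause is empty and every clause number is hit
  have hne : ne φ = φ.length := by
    have hle := Finset.card_le_card hCsub
    rw [hCcard, Nat.card_Icc] at hle
    have := ne_le_length φ
    omega
  have hall : ∀ c ∈ φ, c ≠ [] := (ne_eq_length_iff φ).1 hne
  have hCeq : C = Finset.Icc 1 φ.length :=
    Finset.eq_of_subset_of_card_le (hne ▸ hCsub) (by rw [hCcard, Nat.card_Icc]; omega)
  -- the assignment: a variable is true iff some node of the clique is its positive literal
  let σ : ℕ → Bool := fun v => decide (∃ p ∈ s, (A[p]).2 = (encodeNat v, true))
  refine ⟨σ, (CNF.eval_eq_true_iff φ σ).2 fun c hc => ?_⟩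
  obtain ⟨i, hi, rfl⟩ := List.mem_iff_getElem.1 hc
  have hiC : i + 1 ∈ C := by rw [hCeq, Finset.mem_Icc]; omega
  rw [hC, Finset.mem_image] at hiC
  obtain ⟨p, hp, hpi⟩ := hiC
  -- the node `p` is an occurrence of a literal `l` of clause `i`
  obtain ⟨i', hi', l, hl, hpl⟩ := (h2 hall _).1 (hmemA p)
  have hii' : i' = i := by
    have e := congrArg Prod.fst hpl
    simp only [annLit] at e
    change (A[p]).1 = i + 1 at hpi
    omega
  subst hii'
  -- `l` is true under `σ`
  refine (clause_eval_eq_true_iff σ _).2 ⟨l, hl, ?_⟩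
  rw [Literal.eval, beq_iff_eq]
  cases hb : l.2
  · -- a negative literal: no node of the clique is the positive literal of the same variable
    simp only [σ, decide_eq_false_iff_not]
    rintro ⟨q, hq, hq2⟩
    have hp2 : (A[p]).2 = (encodeNat l.1, false) := by rw [hpl]; simp [annLit, hb]
    have hpq : p ≠ q := by
      rintro rfl
      rw [hp2] at hq2
      simp at hq2
    have hc2 := ((compatB_eq_true_iff _ _).1 (hadj p hp q hq hpq)).2
    rw [hp2, hq2] at hc2
    simp at hc2
  · simp only [σ, decide_eq_true_eq]
    exact ⟨p, hp, by rw [hpl]; simp [annLit, hb]⟩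

/-- **Karp 1972, SATISFIABILITY ∝ CLIQUE**: for the graph on an annotated occurrence list `A` of `φ`
(any `A` with the two membership properties of `annot 0 φ`), `G` has `|φ|` mutually adjacent nodes
iff `φ` is satisfiable. [cite: Karp1972, §4 (Main Theorem, proof: SATISFIABILITY ∝ CLIQUE)] -/
theorem karp_clique_iff (h1 : ∀ x ∈ A, 1 ≤ x.1 ∧ x.1 ≤ ne φ)
    (h2 : (∀ c ∈ φ, c ≠ []) → ∀ x : Ann, x ∈ A ↔ ∃ (i : ℕ) (_ : i < φ.length), ∃ l ∈ φ[i], x = annLit (i + 1) l) :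
    ¬ (graphOf A).CliqueFree φ.length ↔ φ.Satisfiable :=
  ⟨satisfiable_of_not_cliqueFree h1 h2, not_cliqueFree_of_satisfiable h2⟩

/-- The two membership properties hold for `A = annot 0 φ`. [folklore] -/
theorem annot_props (φ : CNF ℕ) :
    (∀ x ∈ annot 0 φ, 1 ≤ x.1 ∧ x.1 ≤ ne φ) ∧
      ((∀ c ∈ φ, c ≠ []) → ∀ x : Ann, x ∈ annot 0 φ ↔ ∃ (i : ℕ) (_ : i < φ.length), ∃ l ∈ φ[i], x = annLit (i + 1) l) := by
  refine ⟨fun x hx => by simpa using fst_mem_annot_bounds 0 φ x hx, fun h x => ?_⟩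
  rw [mem_annot_iff 0 φ h x]
  simp only [Nat.zero_add]

/-- **Karp's reduction for the annotated list of `φ` itself.** [cite: Karp1972, §4 (SATISFIABILITY ∝ CLIQUE)] -/
theorem karp_clique_iff_annot (φ : CNF ℕ) :
    ¬ (graphOf (annot 0 φ)).CliqueFree φ.length ↔ φ.Satisfiable :=
  karp_clique_iff (annot_props φ).1 (annot_props φ).2

end Karp

end KarpClique

end Literature.Computability.Complexity
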